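import Summits.FinalStateConjecture.FinalStateConjecture.Theorems.SwallowTheDatumKerrShieldedSettlesStubKerrExteriorDecompositionAdapters
import Summits.FinalStateConjecture.FinalStateConjecture.Theorems.SwallowTheDatumKerrShieldedSettlesStubKerrExteriorDecompositionProfile
import Literature.Geometry.Lorentzian.KerrConvergence
import HarnessLib

/-!
# `KerrShieldedSettles`, line `tapered-temporal-collar` — stub S6a, part C: the two late-time charts

The hole chart `holeChart : Kerr.exterior M a → Kerr.region a r₁` (`holeMap(x) = x + (F(x⁰, r x) − x⁰)•∂₀`)
and the flat chart `flatChart : flatDomain a τ₀ → Kerr.region a r₁` (`flatMap(x) = x + (c₀ + T(r x))•∂₀`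
on `U₀ = {τ₀ < x⁰, √x⁰ < r}`), `c₀ = M + 3`: smoothness, radius preservation, the near-zone translation
identity, the `∂₀`-derivatives of the shifts, all values in `O_K = {r > r₊, T(r) ≤ x⁰}`, and
**`IsLateChart`** for both (open embeddings on the late regions by the inverse function theorem and
monotonicity in the chart time). References: DHRT arXiv:2104.08222 §1; Lee, Thm. 4.5.
-/

set_option linter.dupNamespace false

noncomputable section

open Set Filter Topology
open scoped Manifold ContDiff Topology ENNReal
open Literature.Geometry.Lorentzian
open Summit.FinalStateConjecture.FinalStateConjecture.Theorems.KerrShieldedDataExist.Negative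
  (bentHeight contDiff_bentHeight)

namespace Summit.FinalStateConjecture.FinalStateConjecture.Theorems.SwallowTheDatum.KerrShieldedSettles

namespace ExteriorDecomposition


/-! ## The hole chart `Ψ₁` -/

section Hole

variable (M a τ₀ : ℝ)

/-- The time shift of the hole chart: `x ↦ F(x⁰, r x) − x⁰` (`c₀ = M + 3`). [folklore] -/
def holeShift (x : E4) : ℝ := holeTime M a τ₀ (M + 3) (x 0) (Kerr.radius a x) - x 0

/-- The hole chart on `E4`: `Ψ₁(x) = x + (F(x⁰, r x) − x⁰)•∂₀ = (F(x⁰, r x), x⃗)`. [folklore] -/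
def holeMap (x : E4) : E4 := x + holeShift M a τ₀ x • E4.basisVector 0

variable {M a τ₀}

/-- The time coordinate of the hole chart is the hole chart time. [folklore] -/
@[simp]
theorem holeMap_apply_zero (x : E4) :
    holeMap M a τ₀ x 0 = holeTime M a τ₀ (M + 3) (x 0) (Kerr.radius a x) := by
  simp [holeMap, holeShift]

/-- The hole chart does not move the spatial part. [folklore] -/
@[simp]
theorem spatial_holeMap (x : E4) : E4.spatial (holeMap M a τ₀ x) = E4.spatial x := by
  rw [holeMap, Kerr.spatial_add_smul_basisVector_zero]

/-- The hole chart preserves the Kerr–Schild radius. [folklore] -/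
@[simp]
theorem radius_holeMap (x : E4) : Kerr.radius a (holeMap M a τ₀ x) = Kerr.radius a x := by
  rw [holeMap, Kerr.radius_add_time_smul_basisVector]

/-- The hole shift is `C^∞` where `r > 0` (`τ₀ ≥ 1`, sub-extremal). [folklore] -/
theorem contDiffAt_holeShift (ha : |a| < M) (hτ₀ : 1 ≤ τ₀) {x : E4} (hx : 0 < Kerr.radius a x) :
    ContDiffAt ℝ ∞ (holeShift M a τ₀) x :=
  (contDiffAt_holeTime_radius (c₀ := M + 3) ha hτ₀ hx).sub (contDiff_euclidean.1 contDiff_id 0).contDiffAt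

/-- On the late near zone `{τ₀ < x⁰, r < 2R(x⁰)}` the hole chart is the Kerr–Schild time
translation by `c₀ = M + 3`. [folklore] -/
theorem holeMap_eq_add_of_near {x : E4} (hx : τ₀ ≤ x 0) (hr : Kerr.radius a x ≤ 2 * nearR (x 0)) :
    holeMap M a τ₀ x = x + (M + 3) • E4.basisVector 0 := by
  rw [holeMap, holeShift, holeTime_late_near hx hr]
  congr 1
  ring_nf

/-- The `∂₀`-derivative of the hole shift at a late point is `∂ₛF − 1`. [folklore] -/
theorem fderiv_holeShift_basisVector (ha : |a| < M) (hτ₀ : 1 ≤ τ₀) {x : E4} (hx : 0 < Kerr.radius a x)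
    (hs : τ₀ < x 0) :
    fderiv ℝ (holeShift M a τ₀) x (E4.basisVector 0) =
      bentHeight M a (Kerr.radius a x) * (deriv Real.smoothTransition (Kerr.radius a x / nearR (x 0) - 2) *
        (Kerr.radius a x * (-(1 / (2 * Real.sqrt (x 0))) / nearR (x 0) ^ 2))) := by
  set r := Kerr.radius a x
  set D := 1 + bentHeight M a r * (deriv Real.smoothTransition (r / nearR (x 0) - 2) *
        (r * (-(1 / (2 * Real.sqrt (x 0))) / nearR (x 0) ^ 2)))
  have hdiff : DifferentiableAt ℝ (holeShift M a τ₀) x :=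
    (contDiffAt_holeShift ha hτ₀ hx).differentiableAt (by simp)
  -- restrict to the line `t ↦ x + t ∂₀`
  have hline : HasDerivAt (fun t : ℝ ↦ x + t • E4.basisVector 0) (E4.basisVector 0) 0 := by
    have := ((hasDerivAt_id (0 : ℝ)).smul_const (E4.basisVector 0)).const_add x
    rwa [one_smul] at this
  have h1 : HasDerivAt (fun t : ℝ ↦ holeShift M a τ₀ (x + t • E4.basisVector 0))
      (fderiv ℝ (holeShift M a τ₀) x (E4.basisVector 0)) 0 :=
    hdiff.hasFDerivAt.comp_hasDerivAt_of_eq (0 : ℝ) hline (by simp)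
  have h2 : HasDerivAt (fun t : ℝ ↦ holeShift M a τ₀ (x + t • E4.basisVector 0)) (D - 1) 0 := by
    have hF := hasDerivAt_holeTime (M := M) (a := a) (c₀ := M + 3) hs
      ((lt_of_lt_of_le one_pos hτ₀).trans hs) r
    have hg : HasDerivAt (fun t : ℝ ↦ x 0 + t) 1 0 := (hasDerivAt_id (0 : ℝ)).const_add (x 0)
    have hF' := hF.comp_of_eq (0 : ℝ) hg (by simp)
    have h2' : HasDerivAt (fun t : ℝ ↦ holeTime M a τ₀ (M + 3) (x 0 + t) r - (x 0 + t)) (D * 1 - 1) 0 :=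
      hF'.sub hg
    have heq : (fun t : ℝ ↦ holeShift M a τ₀ (x + t • E4.basisVector 0)) =
        fun t ↦ holeTime M a τ₀ (M + 3) (x 0 + t) r - (x 0 + t) := by
      funext t
      simp [holeShift, r, Kerr.radius_add_time_smul_basisVector]
    rw [heq]
    convert h2' using 1
    ring
  have := h1.unique h2
  rw [this]
  simp [D]

end Hole

/-! ## The flat chart `Ψ₀` -/

section Flat

variable (M a τ₀ : ℝ)

/-- The flat chart domain `U₀ = {τ₀ < x⁰, √x⁰ < r(x)}` (late half-space minus the tube
`{r ≤ √x⁰}` around the hole; open). [folklore] -/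
def flatDomain : TopologicalSpace.Opens E4 :=
  ⟨{x | τ₀ < x 0 ∧ Real.sqrt (x 0) < Kerr.radius a x}, by
    have h0 : Continuous fun x : E4 ↦ x 0 := PiLp.continuous_apply 2 _ 0
    exact (isOpen_lt continuous_const h0).inter
      (isOpen_lt (Real.continuous_sqrt.comp h0) (Kerr.continuous_radius a))⟩

/-- Membership in the flat domain (by `Iff.rfl`). [folklore] -/
theorem mem_flatDomain {x : E4} :
    x ∈ flatDomain a τ₀ ↔ τ₀ < x 0 ∧ Real.sqrt (x 0) < Kerr.radius a x := Iff.rfl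

/-- The time shift of the flat chart: `x ↦ c₀ + T(r x)` (`c₀ = M + 3`). [folklore] -/
def flatShift (x : E4) : ℝ := (M + 3) + bentHeight M a (Kerr.radius a x)

/-- The flat chart on `E4`: `Ψ₀(x) = x + (c₀ + T(r x))•∂₀ = (x⁰ + c₀ + T(r x), x⃗)`. [folklore] -/
def flatMap (x : E4) : E4 := x + flatShift M a x • E4.basisVector 0

variable {M a τ₀}

/-- The time coordinate of the flat chart. [folklore] -/
@[simp]
theorem flatMap_apply_zero (x : E4) :
    flatMap M a x 0 = x 0 + (M + 3) + bentHeight M a (Kerr.radius a x) := by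
  simp [flatMap, flatShift, add_assoc]

/-- The flat chart does not move the spatial part. [folklore] -/
@[simp]
theorem spatial_flatMap (x : E4) : E4.spatial (flatMap M a x) = E4.spatial x := by
  rw [flatMap, Kerr.spatial_add_smul_basisVector_zero]

/-- The flat chart preserves the Kerr–Schild radius. [folklore] -/
@[simp]
theorem radius_flatMap (x : E4) : Kerr.radius a (flatMap M a x) = Kerr.radius a x := by
  rw [flatMap, Kerr.radius_add_time_smul_basisVector]

/-- The flat shift is `C^∞` where `r > 0`. [folklore] -/
theorem contDiffAt_flatShift (ha : |a| < M) {x : E4} (hx : 0 < Kerr.radius a x) :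
    ContDiffAt ℝ ∞ (flatShift M a) x :=
  contDiffAt_const.add ((contDiff_bentHeight ha).contDiffAt.comp x (Kerr.contDiffAt_radius hx))

/-- The flat shift does not depend on `x⁰`: its `∂₀`-derivative vanishes. [folklore] -/
theorem fderiv_flatShift_basisVector (ha : |a| < M) {x : E4} (hx : 0 < Kerr.radius a x) :
    fderiv ℝ (flatShift M a) x (E4.basisVector 0) = 0 := by
  have hdiff : DifferentiableAt ℝ (flatShift M a) x := (contDiffAt_flatShift ha hx).differentiableAt (by simp)
  have hline : HasDerivAt (fun t : ℝ ↦ x + t • E4.basisVector 0) (E4.basisVector 0) 0 := by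
    have := ((hasDerivAt_id (0 : ℝ)).smul_const (E4.basisVector 0)).const_add x
    rwa [one_smul] at this
  have h1 : HasDerivAt (fun t : ℝ ↦ flatShift M a (x + t • E4.basisVector 0))
      (fderiv ℝ (flatShift M a) x (E4.basisVector 0)) 0 :=
    hdiff.hasFDerivAt.comp_hasDerivAt_of_eq (0 : ℝ) hline (by simp)
  have h2 : HasDerivAt (fun t : ℝ ↦ flatShift M a (x + t • E4.basisVector 0)) 0 0 := by
    have heq : (fun t : ℝ ↦ flatShift M a (x + t • E4.basisVector 0)) = fun _ ↦ flatShift M a x := by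
      funext t; simp [flatShift, Kerr.radius_add_time_smul_basisVector]
    rw [heq]; exact hasDerivAt_const _ _
  exact h1.unique h2

end Flat



/-! ## Small facts -/

/-- The Kerr–Schild radius depends on the spatial part only. [cite: arXiv07060622, (35)] -/
theorem radius_eq_of_spatial_eq {a : ℝ} {x y : E4} (h : E4.spatial x = E4.spatial y) :
    Kerr.radius a x = Kerr.radius a y := by
  rw [← E4.ofTimeSpace_time_spatial x, ← E4.ofTimeSpace_time_spatial y, h,
    KerrShieldedDataExist.Negative.radius_ofTimeSpace,
    KerrShieldedDataExist.Negative.radius_ofTimeSpace a (E4.time y)]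

/-- Sub-extremal parameters have `0 < r₊`. [folklore] -/
theorem rPlus_pos {M a : ℝ} (ha : |a| < M) : 0 < Kerr.rPlus M a := by
  have hM : 0 < M := lt_of_le_of_lt (abs_nonneg a) ha
  unfold Kerr.rPlus
  linarith [Real.sqrt_nonneg (M ^ 2 - a ^ 2)]

section LateCharts

variable {M a r₁ τ₀ : ℝ}

/-! ## The hole chart as a map of the Kerr exterior into the chart `Kerr.region a r₁` -/

variable (M a r₁ τ₀) in
/-- **The hole chart** `Ψ₁ : Kerr.exterior M a → Kerr.region a r₁`, `Ψ₁ = holeMap` (the junction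
radius satisfies `r₁ ≤ r₊`, so the exterior lies in the chart). [folklore] -/
def holeChart (h : r₁ ≤ Kerr.rPlus M a) (x : Kerr.exterior M a) : Kerr.region a r₁ :=
  ⟨holeMap M a τ₀ x, by
    rw [Kerr.mem_region, radius_holeMap]
    exact lt_of_le_of_lt (max_le_max h le_rfl) x.2⟩

/-- The hole chart read on `E4`. [folklore] -/
@[simp]
theorem holeChart_coe (h : r₁ ≤ Kerr.rPlus M a) (x : Kerr.exterior M a) :
    (holeChart M a r₁ τ₀ h x : E4) = holeMap M a τ₀ x := rfl

/-- The hole chart on `E4` is `C^∞` at points with `r > 0`. [folklore] -/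
theorem contDiffAt_holeMap (ha : |a| < M) (hτ₀ : 1 ≤ τ₀) {x : E4} (hx : 0 < Kerr.radius a x) :
    ContDiffAt ℝ ∞ (holeMap M a τ₀) x :=
  contDiffAt_id.add ((contDiffAt_holeShift ha hτ₀ hx).smul contDiffAt_const)

/-- The hole chart is smooth. [folklore] -/
theorem contMDiff_holeChart (ha : |a| < M) (hτ₀ : 1 ≤ τ₀) (h : r₁ ≤ Kerr.rPlus M a) :
    ContMDiff 𝓘(ℝ, E4) 𝓘(ℝ, E4) ∞ (holeChart M a r₁ τ₀ h) :=
  contMDiff_of_repr _ (holeMap M a τ₀) (fun _ ↦ rfl) fun y ↦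
    contDiffAt_holeMap ha hτ₀ (Kerr.radius_pos_of_mem_region y.2)

/-- Every value of the hole chart lies in `O_K = {r > r₊, T(r) ≤ x⁰}` (`τ₀ ≥ 2`). [folklore] -/
theorem holeChart_mem (ha : |a| < M) (hτ₀ : 2 ≤ τ₀) (h : r₁ ≤ Kerr.rPlus M a) (x : Kerr.exterior M a) :
    Kerr.rPlus M a < Kerr.radius a (holeChart M a r₁ τ₀ h x : E4) ∧
      bentHeight M a (Kerr.radius a (holeChart M a r₁ τ₀ h x : E4)) ≤ (holeChart M a r₁ τ₀ h x : E4) 0 := by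
  rw [holeChart_coe, radius_holeMap, holeMap_apply_zero]
  exact ⟨Kerr.lt_radius_of_mem_region x.2,
    bentHeight_le_holeTime ha hτ₀ (Kerr.radius_nonneg a x)⟩

/-- **The hole chart is a late-time chart** of the Kerr spacetime `Kerr.spacetime M a r₁ hM` for the
Kerr background `Kerr.background M a`, into `O_K`, after time `τ₀` (beyond the threshold of
`exists_threshold`, given here as the hypothesis `hpos`). [folklore] -/
theorem isLateChart_holeChart [Kerr.Facts] (ha : |a| < M) (hM : 0 ≤ M) (hτ₀ : 2 ≤ τ₀) (h : r₁ ≤ Kerr.rPlus M a)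
    (hpos : ∀ r : ℝ, 0 ≤ r → ∀ s : ℝ, τ₀ < s →
      0 < 1 + bentHeight M a r * (deriv Real.smoothTransition (r / nearR s - 2) *
        (r * (-(1 / (2 * Real.sqrt s)) / nearR s ^ 2)))) :
    (Kerr.spacetime M a r₁ hM).IsLateChart (Kerr.background M a)
      {x : Kerr.region a r₁ | Kerr.rPlus M a < Kerr.radius a (x : E4) ∧
        bentHeight M a (Kerr.radius a (x : E4)) ≤ (x : E4) 0} τ₀ (holeChart M a r₁ τ₀ h) := by
  have hτ1 : 1 ≤ τ₀ := by linarith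
  have hcont := (contMDiff_holeChart (τ₀ := τ₀) ha hτ1 h).continuous
  refine ⟨contMDiff_holeChart ha hτ1 h, ?_, ?_⟩
  · -- open embedding on the late region
    have hV : IsOpen ((Kerr.background M a).lateRegion τ₀) :=
      isOpen_lt continuous_const ((PiLp.continuous_apply 2 _ 0).comp continuous_subtype_val)
    refine isOpenEmbedding_restrict_of_repr _ (holeMap M a τ₀) hV (fun _ _ ↦ rfl) hcont ?_ ?_
    · -- injectivity: strict monotonicity of the chart time along the time fibres
      refine injOn_timeShift fun x hx y hy hsp hlt ↦ ?_
      obtain ⟨x', hx', rfl⟩ := hx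
      obtain ⟨y', hy', rfl⟩ := hy
      have hx0 : τ₀ < (x' : E4) 0 := hx'
      have hy0 : τ₀ < (y' : E4) 0 := hy'
      have hr : Kerr.radius a (x' : E4) = Kerr.radius a (y' : E4) := radius_eq_of_spatial_eq hsp
      have hmono := strictMonoOn_holeTime (M := M) (a := a) (τ₀ := τ₀) (c₀ := M + 3)
        (by linarith) (hpos (Kerr.radius a (y' : E4)) (Kerr.radius_nonneg a _))
      have := hmono (le_of_lt hx0) (le_of_lt hy0) hlt
      simp only [holeShift, hr] at this ⊢
      linarith
    · -- local homeomorphism: inverse function theorem, `1 + ∂₀(shift) = ∂ₛF > 0`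
      intro x hx
      have hx0 : τ₀ < (x : E4) 0 := hx
      have hr := Kerr.radius_pos_of_mem_region x.2
      refine map_nhds_timeShift (contDiffAt_holeShift ha hτ1 hr) (by simp) ?_
      rw [fderiv_holeShift_basisVector ha hτ1 hr hx0]
      exact (hpos _ (Kerr.radius_nonneg a _) _ hx0).ne'
  · rintro _ ⟨x, -, rfl⟩
    exact holeChart_mem ha hτ₀ h x

/-! ## The flat chart as a map of the flat domain into the chart -/

variable (M a r₁ τ₀) in
/-- **The flat chart** `Ψ₀ : U₀ → Kerr.region a r₁`, `Ψ₀ = flatMap` (on `U₀` one has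
`r > √x⁰ > √τ₀ ≥ r₊ ≥ r₁`). [folklore] -/
def flatChart (hτ : Kerr.rPlus M a ≤ Real.sqrt τ₀) (h : r₁ ≤ Kerr.rPlus M a) (h0 : 0 < Kerr.rPlus M a)
    (x : flatDomain a τ₀) : Kerr.region a r₁ :=
  ⟨flatMap M a x, by
    rw [Kerr.mem_region, radius_flatMap]
    have h1 : Kerr.rPlus M a < Kerr.radius a (x : E4) :=
      lt_of_le_of_lt (hτ.trans (Real.sqrt_le_sqrt x.2.1.le)) x.2.2
    exact lt_of_le_of_lt (max_le h h0.le) h1⟩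

/-- The flat chart read on `E4`. [folklore] -/
@[simp]
theorem flatChart_coe (hτ : Kerr.rPlus M a ≤ Real.sqrt τ₀) (h : r₁ ≤ Kerr.rPlus M a)
    (h0 : 0 < Kerr.rPlus M a) (x : flatDomain a τ₀) :
    (flatChart M a r₁ τ₀ hτ h h0 x : E4) = flatMap M a x := rfl

/-- The flat chart on `E4` is `C^∞` at points with `r > 0`. [folklore] -/
theorem contDiffAt_flatMap (ha : |a| < M) {x : E4} (hx : 0 < Kerr.radius a x) :
    ContDiffAt ℝ ∞ (flatMap M a) x :=
  contDiffAt_id.add ((contDiffAt_flatShift ha hx).smul contDiffAt_const)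

/-- Points of the flat domain have `r > r₊ > 0`. [folklore] -/
theorem rPlus_lt_radius_of_mem_flatDomain (hτ : Kerr.rPlus M a ≤ Real.sqrt τ₀) (x : flatDomain a τ₀) :
    Kerr.rPlus M a < Kerr.radius a (x : E4) :=
  lt_of_le_of_lt (hτ.trans (Real.sqrt_le_sqrt x.2.1.le)) x.2.2

/-- Every value of the flat chart lies in `O_K`. [folklore] -/
theorem flatChart_mem (ha : |a| < M) (hτ : Kerr.rPlus M a ≤ Real.sqrt τ₀) (h : r₁ ≤ Kerr.rPlus M a)
    (h0 : 0 < Kerr.rPlus M a) (hτ₀ : 0 ≤ τ₀) (x : flatDomain a τ₀) :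
    Kerr.rPlus M a < Kerr.radius a (flatChart M a r₁ τ₀ hτ h h0 x : E4) ∧
      bentHeight M a (Kerr.radius a (flatChart M a r₁ τ₀ hτ h h0 x : E4)) ≤
        (flatChart M a r₁ τ₀ hτ h h0 x : E4) 0 := by
  rw [flatChart_coe, radius_flatMap, flatMap_apply_zero]
  refine ⟨rPlus_lt_radius_of_mem_flatDomain hτ x, ?_⟩
  have hM : 0 < M := lt_of_le_of_lt (abs_nonneg a) ha
  have : τ₀ < (x : E4) 0 := x.2.1
  linarith

/-- **The flat chart is a late-time chart** for the Minkowski background on `U₀`, into `O_K`,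
after time `τ₀`. [folklore] -/
theorem isLateChart_flatChart [Kerr.Facts] (ha : |a| < M) (hM : 0 ≤ M) (hτ : Kerr.rPlus M a ≤ Real.sqrt τ₀)
    (h : r₁ ≤ Kerr.rPlus M a) (h0 : 0 < Kerr.rPlus M a) (hτ₀ : 0 ≤ τ₀) :
    (Kerr.spacetime M a r₁ hM).IsLateChart (Minkowski.backgroundOn (flatDomain a τ₀))
      {x : Kerr.region a r₁ | Kerr.rPlus M a < Kerr.radius a (x : E4) ∧
        bentHeight M a (Kerr.radius a (x : E4)) ≤ (x : E4) 0} τ₀ (flatChart M a r₁ τ₀ hτ h h0) := by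
  have hsmooth : ContMDiff 𝓘(ℝ, E4) 𝓘(ℝ, E4) ∞ (flatChart M a r₁ τ₀ hτ h h0) :=
    contMDiff_of_repr _ (flatMap M a) (fun _ ↦ rfl) fun y ↦
      contDiffAt_flatMap ha ((h0.trans (rPlus_lt_radius_of_mem_flatDomain hτ y)))
  refine ⟨hsmooth, ?_, ?_⟩
  · have hV : IsOpen ((Minkowski.backgroundOn (flatDomain a τ₀)).lateRegion τ₀) :=
      isOpen_lt continuous_const ((PiLp.continuous_apply 2 _ 0).comp continuous_subtype_val)
    refine isOpenEmbedding_restrict_of_repr _ (flatMap M a) hV (fun _ _ ↦ rfl) hsmooth.continuous ?_ ?_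
    · refine injOn_timeShift fun x hx y hy hsp hlt ↦ ?_
      have hr : Kerr.radius a x = Kerr.radius a y := radius_eq_of_spatial_eq hsp
      simp only [flatShift, hr]
      linarith
    · intro x hx
      have hr : 0 < Kerr.radius a (x : E4) := h0.trans (rPlus_lt_radius_of_mem_flatDomain hτ x)
      refine map_nhds_timeShift (contDiffAt_flatShift ha hr) (by simp) ?_
      rw [fderiv_flatShift_basisVector ha hr]
      norm_num
  · rintro _ ⟨x, -, rfl⟩
    exact flatChart_mem ha hτ h h0 hτ₀ x

end LateCharts


/-- **Registered helper stub** (S6a part C): the Kerr–Schild radius depends on the spatial part only. [folklore] -/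
theorem _root_.Summit.FinalStateConjecture.FinalStateConjecture.Theorems.SwallowTheDatum.KerrShieldedSettles.stub_kerrExteriorDecompositionLateCharts :
    ∀ {a : ℝ} {x y : E4}, E4.spatial x = E4.spatial y → Kerr.radius a x = Kerr.radius a y :=
  fun h ↦ radius_eq_of_spatial_eq h

end ExteriorDecomposition

end Summit.FinalStateConjecture.FinalStateConjecture.Theorems.SwallowTheDatum.KerrShieldedSettles

end
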